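import Literature.NumberTheory.LFunctions.SoundararajanTypicalOrdinates
import Literature.NumberTheory.LFunctions.LindelofMuConvexity
import HarnessLib

/-!
# `|x^z ζ(z)⁻¹|` at a typical ordinate (Balazard–de Roton 2008, Proposition 9, from Proposition 1)

Topic `Literature/NumberTheory/LFunctions`; a brick of the reduction of
`Literature.NumberTheory.LFunctions.BalazardDeRoton2010_thm1` to the engine statements of
Soundararajan's method (see `SoundararajanTypicalOrdinates.lean`). M. Balazard, A. de Roton,
arXiv:0810.3587, §3:

> **Proposition 9.** (HR) Soit `t` assez grand ; `x ≥ t` ; `V'` tel que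
> `(log log t)² ≤ V' ≤ (log t/2)/(log log t/2)` ; `V ≥ V'`. On suppose que `t` est une ordonnée
> `V'`-typique (de taille `T'`). Alors
> `|x^z ζ(z)^{-1}| ≤ √x exp(V log(log x/log t) + 2(1+δ)V log log V + O(Vδ^{-2}))`
> (`V' ≤ (Re z − 1/2) log x ≤ V`, `|Im z| = t`).

Its printed proof is fifteen lines of real analysis from Proposition 1 (`log|x^zζ(z)^{-1}| = Re z log x − log|ζ(z)| ≤ ½ log x + V − log|ζ(z)|`,
then the two cases `Re z − ½ ≤ V'/log T'` and `> V'/log T'` of Prop. 1, and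
`V' log(log x/log T') = V' log(log x/log t) + V' log(log t/log T')`). We prove exactly this
implication: `TypicalPointwise.norm_cpow_mul_inv_zeta_le` takes the conclusion of Proposition 1
(for a fixed `δ`, with its constants `D`, `T₀`) as a hypothesis `hP1` and returns Proposition 9
with the explicit constant `max D 0 + 2` in place of `O(·)`, for `T' ≥ max T₀ (exp (exp 2))`; the
hypothesis `Re z ≤ 2`, absent from the printed Prop. 9, is silently needed by its proof (the case
`Re z − ½ > V'/log T'` uses the second part of Prop. 1, stated for `σ ≤ 2`).

## References

* [BalazardRoton2008] M. Balazard, A. de Roton, arXiv:0810.3587, Prop. 9 (§3, p. 5) and Prop. 1.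
-/

noncomputable section

open Complex Real

namespace Literature.NumberTheory.LFunctions

namespace TypicalPointwise

open Soundararajan

/-- The statement of Balazard–de Roton 2008, Proposition 1, for a fixed `δ` with constants `D`,
`T₀` (the shape in which it is consumed). [cite: BalazardRoton2008, Prop. 1] -/
def Prop1With (δ D T₀ : ℝ) : Prop :=
  ∀ T : ℝ, T₀ ≤ T → ∀ V : ℝ,
    Real.log (Real.log T) ^ 2 ≤ V → V ≤ Real.log T / Real.log (Real.log T) →
    ∀ t : ℝ, IsTypical δ T V t → ∀ σ : ℝ,
      (1 / 2 < σ → σ ≤ 1 / 2 + V / Real.log T →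
        -(V * Real.log ((V / Real.log T) / (σ - 1 / 2))) - 2 * (1 + δ) * V * Real.log (Real.log V) -
            D * V * δ⁻¹ ^ 2 ≤ Real.log ‖riemannZeta (σ + t * I)‖) ∧
      (1 / 2 + V / Real.log T ≤ σ → σ ≤ 2 → -(D * V * δ⁻¹) ≤ Real.log ‖riemannZeta (σ + t * I)‖)

/-- Elementary: for `T' ≥ exp(exp 2)` and `T' ≤ t ≤ 2T'`: `log(log t/log T') ≤ 1/2`, `1 ≤ log log T'`,
`2 ≤ log T'`. [folklore] -/
lemma log_facts {T' t : ℝ} (hT' : Real.exp (Real.exp 2) ≤ T') (h1 : T' ≤ t) (h2 : t ≤ 2 * T') :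
    Real.log (Real.log t / Real.log T') ≤ 1 / 2 ∧ 2 ≤ Real.log (Real.log T') ∧
      Real.exp 2 ≤ Real.log T' ∧ 0 < T' := by
  have hee : 0 < Real.exp (Real.exp 2) := Real.exp_pos _
  have hT0 : 0 < T' := hee.trans_le hT'
  have hLT : Real.exp 2 ≤ Real.log T' := by
    rw [← Real.log_exp (Real.exp 2)]; exact Real.log_le_log hee hT'
  have he2 : (7 : ℝ) < Real.exp 2 := by
    have := Real.add_one_le_exp (2 : ℝ)
    have h := Real.exp_one_gt_d9
    have : Real.exp 2 = Real.exp 1 * Real.exp 1 := by rw [← Real.exp_add]; norm_num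
    nlinarith
  have hLT0 : 0 < Real.log T' := by linarith
  have hL2 : 2 ≤ Real.log (Real.log T') := by
    rw [← Real.log_exp 2]; exact Real.log_le_log (Real.exp_pos 2) hLT
  refine ⟨?_, hL2, hLT, hT0⟩
  have ht0 : 0 < t := hT0.trans_le h1
  have hlogt : Real.log t ≤ Real.log 2 + Real.log T' := by
    rw [← Real.log_mul (by norm_num) hT0.ne']; exact Real.log_le_log ht0 h2
  have hlog2 : Real.log 2 < 1 := by have := Real.log_two_lt_d9; linarith
  have hratio : Real.log t / Real.log T' ≤ 1 + 1 / Real.log T' := by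
    rw [div_le_iff₀ hLT0, add_mul, one_mul, one_div_mul_cancel hLT0.ne']; linarith
  have hT1 : 1 < T' := by
    by_contra h
    push Not at h
    have := Real.log_nonpos hT0.le h
    linarith
  have hratio0 : 0 < Real.log t / Real.log T' := div_pos (Real.log_pos (by linarith)) hLT0
  calc Real.log (Real.log t / Real.log T') ≤ Real.log t / Real.log T' - 1 := Real.log_le_sub_one_of_pos hratio0
    _ ≤ 1 / Real.log T' := by linarith
    _ ≤ 1 / 2 := one_div_le_one_div_of_le (by norm_num) (by linarith)

/-- **Balazard–de Roton 2008, Proposition 9 from Proposition 1.** Fix `0 < δ ≤ 1` and suppose the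
conclusion of Proposition 1 holds with constants `D`, `T₀` (`hP1`). Then for `T' ≥ max T₀ (exp(exp 2))`,
`(log log T')² ≤ V' ≤ log T'/log log T'`, `V' ≤ V`, `t` a `V'`-typical ordinate of size `T'`, `x ≥ t`
and `z` with `|Im z| = t`, `Re z ≤ 2`, `V' ≤ (Re z − ½) log x ≤ V`:
`‖x^z ζ(z)⁻¹‖ ≤ √x · exp(V log(log x/log t) + 2(1+δ)V log log V + (max D 0 + 2) V δ⁻²)`.
[cite: BalazardRoton2008, Prop. 9] -/
theorem norm_cpow_mul_inv_zeta_le {δ D T₀ : ℝ} (hδ0 : 0 < δ) (hδ1 : δ ≤ 1) (hP1 : Prop1With δ D T₀)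
    {T' V' V t x : ℝ} (hT₀ : T₀ ≤ T') (hTe : Real.exp (Real.exp 2) ≤ T')
    (hV'1 : Real.log (Real.log T') ^ 2 ≤ V') (hV'2 : V' ≤ Real.log T' / Real.log (Real.log T'))
    (hVV : V' ≤ V) (ht : IsTypical δ T' V' t) (hxt : t ≤ x) {z : ℂ} (hz : |z.im| = t)
    (hz1 : V' ≤ (z.re - 1 / 2) * Real.log x) (hz2 : (z.re - 1 / 2) * Real.log x ≤ V)
    (hre2 : z.re ≤ 2) :
    ‖(x : ℂ) ^ z * (riemannZeta z)⁻¹‖ ≤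
      Real.sqrt x * Real.exp (V * Real.log (Real.log x / Real.log t) +
        2 * (1 + δ) * V * Real.log (Real.log V) + (max D 0 + 2) * V * δ⁻¹ ^ 2) := by
  obtain ⟨hT't, ht2T⟩ := ht.size
  obtain ⟨hloglog, hL2, hLT, hT0⟩ := log_facts hTe hT't ht2T
  have ht0 : 0 < t := hT0.trans_le hT't
  have hx0 : 0 < x := ht0.trans_le hxt
  have hLT0 : 0 < Real.log T' := (Real.exp_pos 2).trans_le hLT
  have hLL0 : 0 < Real.log (Real.log T') := by linarith
  -- sizes of `V'`, `V`
  have hV'4 : 4 ≤ V' := by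
    have : (2 : ℝ) ^ 2 ≤ Real.log (Real.log T') ^ 2 := pow_le_pow_left₀ (by norm_num) hL2 2
    linarith
  have hV'0 : 0 < V' := by linarith
  have hV0 : 0 < V := by linarith
  have hlogV' : 1 ≤ Real.log V' := by
    rw [← Real.log_exp 1]
    refine Real.log_le_log (Real.exp_pos 1) ?_
    have := Real.exp_one_lt_d9; linarith
  have hllV'0 : 0 ≤ Real.log (Real.log V') := Real.log_nonneg hlogV'
  have hllVV : Real.log (Real.log V') ≤ Real.log (Real.log V) :=
    Real.log_le_log (by linarith) (Real.log_le_log hV'0 hVV)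
  have hllV0 : 0 ≤ Real.log (Real.log V) := hllV'0.trans hllVV
  -- `log x ≥ log t ≥ log T' ≥ e²`
  have hlogt : Real.log T' ≤ Real.log t := Real.log_le_log hT0 hT't
  have hlogx : Real.log t ≤ Real.log x := Real.log_le_log ht0 hxt
  have hlogx0 : 0 < Real.log x := by linarith
  have hlogt0 : 0 < Real.log t := by linarith
  have hlxt : 0 ≤ Real.log (Real.log x / Real.log t) :=
    Real.log_nonneg ((one_le_div hlogt0).2 hlogx)
  -- `Re z − ½ > 0`
  have hσ' : 0 < z.re - 1 / 2 := by
    by_contra h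
    push Not at h
    have : (z.re - 1 / 2) * Real.log x ≤ 0 := mul_nonpos_of_nonpos_of_nonneg h hlogx0.le
    linarith
  -- the norm of `x^z`
  have hxz : ‖(x : ℂ) ^ z‖ = Real.sqrt x * Real.exp ((z.re - 1 / 2) * Real.log x) := by
    rw [Complex.norm_cpow_eq_rpow_re_of_pos hx0, Real.sqrt_eq_rpow, Real.rpow_def_of_pos hx0,
      Real.rpow_def_of_pos hx0, ← Real.exp_add]
    congr 1; ring
  -- reduce to a bound on `−log‖ζ z‖`
  have hδi1 : 1 ≤ δ⁻¹ := (one_le_inv₀ hδ0).2 hδ1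
  have hδ2 : 1 ≤ δ⁻¹ ^ 2 := one_le_pow₀ hδi1
  have hδ12 : δ⁻¹ ≤ δ⁻¹ ^ 2 := le_self_pow₀ hδi1 (by norm_num)
  set B : ℝ := V * Real.log (Real.log x / Real.log t) + 2 * (1 + δ) * V * Real.log (Real.log V) +
    (max D 0 + 2) * V * δ⁻¹ ^ 2 with hB
  -- it suffices: `(Re z − ½) log x − log‖ζ z‖ ≤ B` when `ζ z ≠ 0`
  by_cases hζ : riemannZeta z = 0
  · rw [hζ, inv_zero, mul_zero, norm_zero]; positivity
  have hmain : (z.re - 1 / 2) * Real.log x - Real.log ‖riemannZeta z‖ ≤ B := by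
    -- write `z = σ + i(±t)` and use Prop. 1 at the typical ordinate `t` of size `T'` with `V'`
    set σ := z.re with hσ
    have hnorm : ‖riemannZeta z‖ = ‖riemannZeta (σ + t * I)‖ := by
      have hz' : z = σ + z.im * I := by apply Complex.ext <;> simp [hσ]
      rcases (abs_eq ht0.le).1 hz with h | h
      · rw [hz', h]
      · rw [hz', h]
        exact norm_riemannZeta_ofReal_add_neg σ t
    rw [hnorm]
    obtain ⟨hc1, hc2⟩ := hP1 T' hT₀ V' hV'1 hV'2 t ht σ
    have hσhalf : 1 / 2 < σ := by rw [hσ]; linarith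
    -- `V' log(log x/log T') ≤ V log(log x/log t) + V'/2`
    have hsplit : V' * Real.log (Real.log x / Real.log T') ≤
        V * Real.log (Real.log x / Real.log t) + V' / 2 := by
      have e : Real.log (Real.log x / Real.log T') =
          Real.log (Real.log x / Real.log t) + Real.log (Real.log t / Real.log T') := by
        rw [← Real.log_mul (div_pos hlogx0 hlogt0).ne' (div_pos hlogt0 hLT0).ne']
        congr 1; field_simp
      rw [e, mul_add]
      have h1 : V' * Real.log (Real.log x / Real.log t) ≤ V * Real.log (Real.log x / Real.log t) :=
        mul_le_mul_of_nonneg_right hVV hlxt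
      have h2 : V' * Real.log (Real.log t / Real.log T') ≤ V' * (1 / 2) :=
        mul_le_mul_of_nonneg_left hloglog hV'0.le
      linarith
    rcases le_or_gt σ (1 / 2 + V' / Real.log T') with hcase | hcase
    · -- case 1: Prop. 1, first part
      have h := hc1 hσhalf hcase
      -- `log((V'/log T')/(σ−½)) ≤ log(log x/log T')` since `σ − ½ ≥ V'/log x`
      have hq : (V' / Real.log T') / (σ - 1 / 2) ≤ Real.log x / Real.log T' := by
        rw [div_le_div_iff₀ hσ' hLT0]
        have : V' ≤ (σ - 1 / 2) * Real.log x := hz1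
        calc V' / Real.log T' * Real.log T' = V' := div_mul_cancel₀ _ hLT0.ne'
          _ ≤ (σ - 1 / 2) * Real.log x := this
          _ = Real.log x * (σ - 1 / 2) := by ring
      have hq0 : 0 < (V' / Real.log T') / (σ - 1 / 2) := by positivity
      have hlogq : Real.log ((V' / Real.log T') / (σ - 1 / 2)) ≤ Real.log (Real.log x / Real.log T') :=
        Real.log_le_log hq0 hq
      have hA : V' * Real.log ((V' / Real.log T') / (σ - 1 / 2)) ≤
          V * Real.log (Real.log x / Real.log t) + V' / 2 :=
        (mul_le_mul_of_nonneg_left hlogq hV'0.le).trans hsplit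
      have hBll : 2 * (1 + δ) * V' * Real.log (Real.log V') ≤ 2 * (1 + δ) * V * Real.log (Real.log V) := by
        have h1 : V' * Real.log (Real.log V') ≤ V * Real.log (Real.log V) :=
          mul_le_mul hVV hllVV hllV'0 hV0.le
        have := mul_le_mul_of_nonneg_left h1 (by positivity : (0 : ℝ) ≤ 2 * (1 + δ))
        linarith
      have hD : D * V' * δ⁻¹ ^ 2 ≤ max D 0 * V * δ⁻¹ ^ 2 := by
        have h1 : D * V' ≤ max D 0 * V' := mul_le_mul_of_nonneg_right (le_max_left _ _) hV'0.le
        have h2 : max D 0 * V' ≤ max D 0 * V := mul_le_mul_of_nonneg_left hVV (le_max_right _ _)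
        exact mul_le_mul_of_nonneg_right (h1.trans h2) (sq_nonneg _)
      have hV'δ : V' / 2 + V ≤ 2 * V * δ⁻¹ ^ 2 := by
        have := mul_le_mul_of_nonneg_left hδ2 (by positivity : (0 : ℝ) ≤ 2 * V)
        linarith
      rw [hB]
      linarith [h, hA, hBll, hD, hV'δ, hz2]
    · -- case 2: Prop. 1, second part
      have h := hc2 hcase.le hre2
      have hD : D * V' * δ⁻¹ ≤ max D 0 * V * δ⁻¹ ^ 2 := by
        have hδi : 0 ≤ δ⁻¹ := (inv_pos.2 hδ0).le
        have h1 : D * V' * δ⁻¹ ≤ max D 0 * V' * δ⁻¹ :=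
          mul_le_mul_of_nonneg_right (mul_le_mul_of_nonneg_right (le_max_left D 0) hV'0.le) hδi
        have h2 : max D 0 * V' * δ⁻¹ ≤ max D 0 * V * δ⁻¹ ^ 2 :=
          mul_le_mul (mul_le_mul_of_nonneg_left hVV (le_max_right _ _)) hδ12 hδi (by positivity)
        exact h1.trans h2
      have hVB : V ≤ 2 * V * δ⁻¹ ^ 2 := by
        have := mul_le_mul_of_nonneg_left hδ2 (by positivity : (0 : ℝ) ≤ 2 * V)
        linarith
      have hpos1 : 0 ≤ V * Real.log (Real.log x / Real.log t) := mul_nonneg hV0.le hlxt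
      have hpos2 : 0 ≤ 2 * (1 + δ) * V * Real.log (Real.log V) := by positivity
      rw [hB]
      linarith [h, hD, hz2, hpos1, hpos2, hVB]
  -- conclude
  have hζpos : 0 < ‖riemannZeta z‖ := norm_pos_iff.2 hζ
  rw [norm_mul, norm_inv, hxz, mul_assoc]
  refine mul_le_mul_of_nonneg_left ?_ (Real.sqrt_nonneg _)
  rw [← Real.exp_log hζpos, ← Real.exp_neg, ← Real.exp_add]
  exact Real.exp_le_exp.2 (by linarith)

end TypicalPointwise

end Literature.NumberTheory.LFunctions

end
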